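import Summits.SmoothPoincare4.SmoothPoincare4.Theses.CongruenceShadows
import Summits.SmoothPoincare4.SmoothPoincare4.Theorems.WaldhausenPairs.Negative.LoadBearing
import Summits.SmoothPoincare4.SmoothPoincare4.Theorems.WaldhausenPairs.Negative.PairTransferFalse
import Literature.Topology.FourManifolds.FreeFundamentalGroupThreeManifold
import Literature.Topology.FourManifolds.ThickenedHandlebodyFour
import HarnessLib
import HarnessLib.Audit

/-!
# Line `zieschang-orbit-dnb-regluing` for crux `CongruenceShadows.WaldhausenPairs` (stmt-SmoothPoincare4-14592)

Skeleton (crux-plan, round 1; idea card `Ideas/zieschang-orbit-dnb-regluing.md`, triage r1-1/2/3: pass):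
**Zieschang's single-orbit theorem for handlebody kernels, proved algebraically, then reglue the
ONE marked model handlebody along a Dehn–Nielsen–Baer diffeomorphism and compare the two reglued
doubles by Kneser–Stallings–Perelman + Waldhausen.**

Notation. `S = SurfaceGroup g`, `N = s4Kernels.stabilizeIter m` (standard `(3+3m; m+1)` triple of
`S⁴`), a *handlebody kernel* is a normal `A ◁ S` with `S ⧸ A ≅ F_g`; for a compact 3-manifold `H`
with boundary datum `b` (`F = b.carrier = ∂H`), a base point `x : F` and a MARKING
`μ : S ≃* π₁(F, x)`, `markedKernel μ e` is the kernel of `π₁(e) : π₁(F, x) → π₁(Z, e x)` pulled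
back to `S` (`e = ∂H ↪ H`: the handlebody kernel of the marked handlebody; `e = (∂H ↪ H) ∘ f`:
the kernel of the copy of `H` reglued along `f : F ≅ F`).

Chain (every arrow is a registered stub `stub_*`; the glue between them is PROVED in this file):

  crux hypotheses (`K` a `(3+3m; m+1)` group trisection of `{1}`, `i ≠ j`)
  —[`stub_handlebodyKernelsOneOrbit` ×2 (W1, ALGEBRAIC, the line's lever: Nielsen–Zieschang
     cancellation for the quadratic relator; uses the load-bearing `free_quotient` of §A)]→
     `K i = αᵢ N i`, `K j = αⱼ N j`; transport (proved inside `WaldhausenPairs_of`) ⇒ it suffices to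
     standardise the REGLUED STANDARD PAIR `(N i, ρ N j)`, `ρ = αⱼ ≫ αᵢ⁻¹`, whose pair quotient is
     still free of rank `m+1` (the load-bearing `free_pairQuotient` of §A, transported) — this is
     `PairRegluing`, proved below as `pairRegluing` from stubs 2–7:
  —[`stub_markedModelHandlebody` (ONE explicit genus-`g` handlebody `H ⊂ ℝ³` — the flower — with
     connected boundary marked by `S`, whose marking kernel is a handlebody kernel) +
     W1 (re-marking, proved: `exists_marking_eq`)]→ a marking `μ` of `∂H` with kernel LITERALLY `N i`
  —[W1 again]→ `θ ∈ Aut S` with `(N i).comap θ = ρ N j` (resp. `= N j`)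
  —[`stub_dehnNielsenBaer` (NEW FACT-LEVEL STUB: every automorphism of `S`, read through `μ`, is
     `T_ζ ∘ f_*` for a diffeomorphism `f` of `∂H` and a path `ζ : f x ⟶ x`)]→ `f_θ : ∂H ≅ ∂H`;
     the kernel of the copy of `H` reglued along `f_θ` is then `(N i).comap θ` (PROVED here:
     `markedKernel_comp_eq_comap`, functoriality of `π₁` + naturality of the change of base point)
  —[`stub_regluedDouble` (glue `Y_f = H ∪_f H`: closed connected orientable smooth 3-manifold,
     Heegaard-split by two copies of `H`; van Kampen through `μ`:
     `π₁(Y_f) ≅ S ⧸ ⟪A ∪ A_f⟫`, `A`, `A_f` the kernels of the two copies)]→ two splittings `Y_ρ`,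
     `Y_1` with kernel pairs `(N i, ρ N j)`, `(N i, N j)` and `π₁` free of rank `m+1`
  —[`stub_kneserStallingsPerelman` + `stub_waldhausen` (the tree's two NAMED FACTS wi-25611 /
     wi-25606, registered as stubs because a skeleton's hypotheses must be registered obligations;
     consumed through the tree's PROVED composite `heegaardSplittings_diffeomorphic_of_isFreeOfRank`
     on the PROVED model `exists_oneHandlebody_four (m+1)`) ]→ a diffeomorphism of triples
     `(Y_1; H, H) ≅ (Y_ρ; H, H)`
  —[`stub_triplesTransport` (`f ↦ f_*`: restrict to `∂H`, change base point, read through `μ`)]→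
     `σ ∈ Aut S`, `σ (N i) = N i`, `σ (N j) = ρ N j` — `PairRegluing`; hence the crux.

`WaldhausenPairs_of : …CongruenceShadows.WaldhausenPairs` is proved at the end from the seven
stubs with NO hypotheses; `sorry` occurs only inside `stub_*`.

Disproof.lean (cdisprove, tree) honoured: §A `waldhausenPairs_false_without_freeQuotient` — W1 is
applied only to kernels with quotient free of rank EXACTLY `g` (`free_quotient`, at every W1 call);
§A `waldhausenPairs_false_without_pairFree` — `free_pairQuotient` is the hypothesis that makes
`π₁(Y_ρ)` free of rank `m+1`, without which the KSP∘Waldhausen comparison has nothing to compare;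
§B `not_pairTransfer` / §B' `not_rigid` — the simultaneous `σ` is produced GEOMETRICALLY by
`stub_triplesTransport` from Waldhausen's diffeomorphism (never `σ = 1`, never a single-kernel
standardisation reused for the other kernel); §C `HeegaardPairOrbit` is a corollary of the same
chain; §D `TripleStandard` is not claimed. Landed negative lemmas
(`Theorems/WaldhausenPairs/Negative/LoadBearing.lean`, `PairTransferFalse.lean`) are IMPORTED here
and two of their positive lemmas (`stabilizeIter_isGroupTrisection`, `IsGroupTrisection.map_mulEquiv`)
are used in the glue; no stub is an instance of a refuted statement (`ledger negatives` = 0).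
PC3-hardness (crux NOTES §1): the Perelman-bearing declaration consumed is `stub_kneserStallingsPerelman`.
-/

set_option linter.dupNamespace false

noncomputable section

open scoped Manifold ContDiff
open Literature.Topology.FourManifolds Subgroup
open Summit.SmoothPoincare4.SmoothPoincare4.Theses.CongruenceShadows (WaldhausenPairs)

namespace Summit.SmoothPoincare4.SmoothPoincare4.Cruxes.WaldhausenPairs.ZieschangOrbitDnbRegluing

/-! ## 0. Vocabulary (definitions over existing declarations) -/

/-- **W1** (Zieschang 1964/65, Grigorchuk–Kurchanov 1990, Leininger–Reid 2002 Lemma 2.2, in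
kernel form): the *handlebody kernels* of `S_g` — normal subgroups with quotient free of rank `g`
— form ONE orbit of `Aut S_g`. Pure `PresentedGroup` statement (no manifold). -/
def HandlebodyKernelsOneOrbit (g : ℕ) : Prop :=
  ∀ A B : Subgroup (SurfaceGroup g), A.Normal → B.Normal →
    IsFreeOfRank (SurfaceGroup g ⧸ normalClosure (A : Set (SurfaceGroup g))) g →
    IsFreeOfRank (SurfaceGroup g ⧸ normalClosure (B : Set (SurfaceGroup g))) g →
    ∃ α : SurfaceGroup g ≃* SurfaceGroup g, A.map α.toMonoidHom = B

/-- The kernel of `π₁(e) : π₁(F, x) → π₁(Z, e x)` read through a marking `μ : S_g ≃* π₁(F, x)`: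
a subgroup of `S_g`. For `e = ∂H ↪ H` (`H` a marked handlebody) this is its handlebody kernel; for
`e = (∂H ↪ H) ∘ f` it is the kernel of the copy of `H` glued on along `f : ∂H ≅ ∂H`. -/
def markedKernel {g : ℕ} {F Z : Type*} [TopologicalSpace F] [TopologicalSpace Z] {x : F}
    (μ : SurfaceGroup g ≃* FundamentalGroup F x) (e : C(F, Z)) : Subgroup (SurfaceGroup g) :=
  (FundamentalGroup.map e x).ker.comap μ.toMonoidHom

/-- **PairRegluing** (the geometric half, card K2): for the standard pair `(N i, N j)` and any
automorphism `ρ` of `S` such that the reglued pair `(N i, ρ N j)` still has pair quotient free of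
rank `m+1`, some `σ ∈ Stab (N i)` carries `N j` to `ρ N j`. Proved below from stubs 2–7. -/
def PairRegluing : Prop :=
  ∀ (m : ℕ) (i j : Fin 3), i ≠ j →
    ∀ ρ : SurfaceGroup (3 + 3 * m) ≃* SurfaceGroup (3 + 3 * m),
      IsFreeOfRank (SurfaceGroup (3 + 3 * m) ⧸ normalClosure
        ((s4Kernels.stabilizeIter m i : Set (SurfaceGroup (3 + 3 * m))) ∪
          (s4Kernels.stabilizeIter m j).map ρ.toMonoidHom)) (m + 1) →
      ∃ σ : SurfaceGroup (3 + 3 * m) ≃* SurfaceGroup (3 + 3 * m),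
        (s4Kernels.stabilizeIter m i).map σ.toMonoidHom = s4Kernels.stabilizeIter m i ∧
        (s4Kernels.stabilizeIter m j).map σ.toMonoidHom =
          (s4Kernels.stabilizeIter m j).map ρ.toMonoidHom

/-! ## 1. The seven registered stubs -/

/-- **STUB 1 · `stub_handlebodyKernelsOneOrbit` · W1 at the crux genera (LOAD-BEARING, the line's
lever).** Any two handlebody kernels of `S_{3+3m}` differ by an automorphism of `S_{3+3m}`.
Route: from `S ⧸ A ≅ F_g` get an epimorphism `φ : S ↠ F_g`, lift to `F_{2g} → F_g` killing
`∏[aᵢ,bᵢ]`, Nielsen-reduce by ATTACHED regular/singular transformations (Lyndon–Schupp I.6.15, I.7.6;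
inner rank `⌊|q|/4⌋ = g`, I.7.13), read off an automorphism of `F_{2g}` stabilising `⟪r⟫`, hence of
`S` (Nielsen 1927 / Zieschang 1966), carrying `ker φ` to `⟪a₁,…,a_g⟫`; compose two of them.
Fallback if the printed proofs turn out to realise curves on the surface (triage r1-3): vendor the
kernel form of Leininger–Reid 2002 Lemma 2.2 as ONE named fact and derive this stub in two lines.
Size XL (L with the fallback). [cite: GrigorchukKurchanov1990] [cite: LeiningerReid2002, Lemma 2.2]
[cite: LyndonSchupp2001, I.6.15, I.7.6, I.7.13] [cite: Zieschang1964] -/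
theorem stub_handlebodyKernelsOneOrbit : ∀ m : ℕ, HandlebodyKernelsOneOrbit (3 + 3 * m) := by
  sorry

/-- **STUB 2 · `stub_markedModelHandlebody` · ONE marked model handlebody per crux genus.**
For every `m` there is a compact Hausdorff second-countable smooth genus-`(3+3m)` handlebody `H`
(`IsHandlebody`) with a boundary datum `b` whose boundary surface `b.carrier` is connected and
MARKED by the surface group at some base point, `μ : S_{3+3m} ≃* π₁(∂H, x)`, such that the marking
kernel `markedKernel μ (∂H ↪ H)` has quotient free of rank `3+3m` (i.e. is a handlebody kernel).
Route: the flower handlebody `FlowerModel.FlowerHandlebody` (`isHandlebody_flowerHandlebody`,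
`g ≥ 2`) with `BoundaryManifold.boundaryData`, its explicit boundary `{q_g + z² = c_g}`
(`boundaryHomeomorph`; connected), a marking of that surface (Hatcher §1.2 p. 51 — the sequel of
`FlowerMarkingTransport.lean`, shared with fact seat (g′)), and the Morse theory of 1-handlebodies
(`HasHandleDecomposition.surjective_inclHom_boundary`, `….isFreeOfRank_fundamentalGroup`): the
quotient by the kernel is `π₁(H) ≅ F_g`. NO re-marking is asked here (W1 does it in the glue).
Size L. [cite: HatcherAT2002, §1.2 p. 51] [cite: Juhasz2023, §3.5] -/
theorem stub_markedModelHandlebody : ∀ m : ℕ,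
    ∃ (H : Type) (_ : TopologicalSpace H) (_ : T2Space H) (_ : SecondCountableTopology H)
      (_ : ChartedSpace (EuclideanHalfSpace 3) H) (_ : IsManifold (𝓡∂ 3) ∞ H)
      (b : BoundaryData (𝓡∂ 3) H (𝓡 2)) (_ : ConnectedSpace b.carrier) (x : b.carrier)
      (μ : SurfaceGroup (3 + 3 * m) ≃* FundamentalGroup b.carrier x),
      IsHandlebody (3 + 3 * m) H ∧
        IsFreeOfRank (SurfaceGroup (3 + 3 * m) ⧸ normalClosure
          (markedKernel μ ⟨b.incl, b.continuous_incl⟩ : Set (SurfaceGroup (3 + 3 * m)))) (3 + 3 * m) := by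
  sorry

/-- **STUB 3 · `stub_dehnNielsenBaer` · Dehn–Nielsen–Baer, manifold form with a base path
(FACT-LEVEL stub: the ONE new deep fact of the line; to be vendored as a Literature named fact and
shared with crux AgkCor6Sufficiency's `binary-product-nielsen`).** For a compact connected Hausdorff
second-countable smooth surface `F` without boundary whose fundamental group at `x` is marked by
`S_g` (so `F` is the closed orientable surface of genus `g`), every automorphism `θ` of `S_g` is
realised: there are a diffeomorphism `f : F ≅ F` and a path `ζ` from `f x` to `x` with
`T_ζ ∘ π₁(f) ∘ μ = μ ∘ θ`, `T_ζ = fundamentalGroupMulEquivOfPath ζ : π₁(F, f x) ≅ π₁(F, x)` the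
change of base point (inner automorphisms are absorbed by the choice of `ζ`; `g = 0`: `f = id`). Farb–Margalit Thm 8.1
(`Mod^±(S_g) → Out(π₁ S_g)` surjective, g ≥ 1) + §1.4 (homeomorphisms vs diffeomorphisms) +
classification of closed surfaces; Zieschang–Vogt–Coldewey §5.6 (combinatorial proof). Size XL as a
proof; statement-level here. [cite: FarbMargalit2012, Thm 8.1, Thm 1.13, Thm 1.1] [cite: ZieschangVogtColdewey1980, §5.6]
[cite: Nielsen1927] -/
theorem stub_dehnNielsenBaer :
    ∀ (F : Type) [TopologicalSpace F] [T2Space F] [SecondCountableTopology F] [CompactSpace F]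
      [ConnectedSpace F] [ChartedSpace (EuclideanSpace ℝ (Fin 2)) F] [IsManifold (𝓡 2) ∞ F]
      (g : ℕ) (x : F) (μ : SurfaceGroup g ≃* FundamentalGroup F x)
      (θ : SurfaceGroup g ≃* SurfaceGroup g),
      ∃ (f : F ≃ₘ⟮𝓡 2, 𝓡 2⟯ F) (ζ : Path (f x) x),
        ∀ s : SurfaceGroup g,
          FundamentalGroup.fundamentalGroupMulEquivOfPath ζ
              (FundamentalGroup.map ⟨f, f.continuous⟩ x (μ s)) = μ (θ s) := by
  sorry

/-- **STUB 4 · `stub_regluedDouble` · the reglued double and its fundamental group.**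
Let `H` be a genus-`g` handlebody (compact Hausdorff second countable) with boundary datum `b`,
connected boundary `F = b.carrier` marked by `μ : S_g ≃* π₁(F, x)`, and let `f : F ≅ F` be any
diffeomorphism. Then the glued manifold `Y = H ∪_f H` exists as a compact connected ORIENTABLE
Hausdorff second-countable smooth 3-manifold without boundary (`exists_isBoundaryGluing_holds`;
orient the second copy so that `f` reverses the boundary orientation — possible because `F` is
connected), with gluing witnesses `j, j'` (`IsBoundaryGluingWith b b f (𝓡 3) j j'`: a genus-`g`
Heegaard splitting of `Y` by two copies of `H`), and Seifert–van Kampen for the closed cover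
`j(H) ∪ j'(H)` collared along `F` (`VanKampen.surjective_and_ker_eq_of_closed_cover_collars`,
`BoundaryData.nonempty_collar_holds`, surjectivity of `π₁(∂H) → π₁(H)` =
`HasHandleDecomposition.surjective_inclHom_boundary`) read through `μ`:
`π₁(Y, j x) ≅ S_g ⧸ ⟪A ∪ A_f⟫` with `A = markedKernel μ (∂H ↪ H)` and
`A_f = markedKernel μ ((∂H ↪ H) ∘ f)` the kernels of the two copies. Perelman-free; shared verbatim
with lines B/D. Size L (the orientability of the gluing is the formal hotspot).
[cite: HatcherAT2002, Thm 1.20] [cite: Hempel1976, Lemma 14.4] [cite: BrockerJanich1982, §13] -/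
theorem stub_regluedDouble :
    ∀ (g : ℕ) (H : Type) [TopologicalSpace H] [T2Space H] [SecondCountableTopology H]
      [ChartedSpace (EuclideanHalfSpace 3) H] [IsManifold (𝓡∂ 3) ∞ H] (_ : IsHandlebody g H)
      (b : BoundaryData (𝓡∂ 3) H (𝓡 2)) [ConnectedSpace b.carrier] (x : b.carrier)
      (μ : SurfaceGroup g ≃* FundamentalGroup b.carrier x)
      (f : b.carrier ≃ₘ⟮𝓡 2, 𝓡 2⟯ b.carrier),
      ∃ (Y : Type) (_ : TopologicalSpace Y) (_ : T2Space Y) (_ : SecondCountableTopology Y)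
        (_ : ChartedSpace (EuclideanSpace ℝ (Fin 3)) Y) (_ : IsManifold (𝓡 3) ∞ Y)
        (_ : CompactSpace Y) (_ : ConnectedSpace Y) (_ : IsOrientable (𝓡 3) Y) (j j' : H → Y),
        IsBoundaryGluingWith b b f (𝓡 3) j j' ∧
        Nonempty (SurfaceGroup g ⧸ normalClosure
            ((markedKernel μ ⟨b.incl, b.continuous_incl⟩ : Set (SurfaceGroup g)) ∪
              markedKernel μ ⟨b.incl ∘ f, b.continuous_incl.comp f.continuous⟩) ≃*
          FundamentalGroup Y (j (b.incl x))) := by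
  sorry

/-- **STUB 5 · `stub_kneserStallingsPerelman` · NAMED FACT `wi-25611` (the Perelman-bearing
declaration the line consumes; crux NOTES §1 / PC3-hardness).** A closed connected orientable smooth
3-manifold with `π₁` free of rank `k` is diffeomorphic to the boundary of every compact connected
orientable 4-dimensional 1-handlebody with `k` 1-handles (`#ᵏ S¹×S²`; `k = 0`: Poincaré). Verbatim
the tree's `Literature.Topology.FourManifolds.diffeomorph_sumS1S2_of_isFreeOfRank_fundamentalGroup`
at universe 0, registered as a stub because a skeleton's hypotheses must be registered obligations.
Permanent fact debt (XL). [cite: AbramsGayKirby2018, p. 4] [cite: Hempel1976, Thm 5.2, 5.3, Thm 7.1]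
[cite: MorganTian2007, Cor. 0.2 (a)] -/
theorem stub_kneserStallingsPerelman : diffeomorph_sumS1S2_of_isFreeOfRank_fundamentalGroup.{0} := by
  sorry

/-- **STUB 6 · `stub_waldhausen` · NAMED FACT `wi-25606`.** Waldhausen (1968): genus-`g` Heegaard
splittings of `#ᵏ(S¹×S²)` are unique — in the ORDERED diffeomorphism-of-triples form the line
consumes. Verbatim the tree's `Literature.Topology.FourManifolds.waldhausen_heegaardSplitting_sumS1S2_unique`
at universe 0 (a skeleton's hypotheses must be registered obligations). Permanent fact debt (XL).
[cite: Waldhausen1968] [cite: MeierSchirmerZupan2016, Thm 2.7] -/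
theorem stub_waldhausen : waldhausen_heegaardSplitting_sumS1S2_unique.{0} := by
  sorry

/-- **STUB 7 · `stub_triplesTransport` · a diffeomorphism of Heegaard triples over one marked
surface is an automorphism of `S_g` carrying kernel pair to kernel pair (`f ↦ f_*`, the easy
direction of Dehn–Nielsen, plus base-point change).** Two gluings `Y = H ∪_f H` (witnesses `j, j'`)
and `Y' = H ∪_{f'} H` (witnesses `J, J'`) of the same smooth 3-manifold `H` with connected MARKED
boundary (no handlebody hypothesis is needed), and a diffeomorphism of
triples `Φ : Y ≅ Y'`, `ψ₁, ψ₂ : H ≅ H`, `Φ ∘ j = J ∘ ψ₁`, `Φ ∘ j' = J' ∘ ψ₂`, give `σ ∈ Aut S_g`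
fixing `markedKernel μ (∂H ↪ H)` and carrying `markedKernel μ ((∂H ↪ H) ∘ f)` onto
`markedKernel μ ((∂H ↪ H) ∘ f')`. Route: `ψ₁` preserves `∂H` (invariance of the boundary under
diffeomorphisms, `Diffeomorph.boundaryHomeomorph`), giving `φ : F ≅ F` with `ψ₁ ∘ ∂ = ∂ ∘ φ`;
similarly `φ'` from `ψ₂`; the gluing relations and injectivity of `J, J'` give `φ' ∘ f = f' ∘ φ`;
`σ := μ⁻¹ ∘ T_δ ∘ π₁(φ) ∘ μ` for a path `δ : x ⟶ φ x` (`F` is a connected manifold, hence path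
connected); kernels of `π₁(∂H ↪ H)` and `π₁((∂H ↪ H) ∘ f)` are carried to the corresponding
kernels because `ψᵢ` induce isomorphisms on `π₁(H)` and base-point change is natural. Perelman-free;
shared verbatim with lines B/D (triage "shared note (i)"). Size M. [cite: HatcherAT2002, Prop. 1.5]
[cite: FarbMargalit2012, §8.1 (σ_f = f_*)] -/
theorem stub_triplesTransport :
    ∀ (g : ℕ) (H : Type) [TopologicalSpace H] [T2Space H] [SecondCountableTopology H]
      [ChartedSpace (EuclideanHalfSpace 3) H] [IsManifold (𝓡∂ 3) ∞ H]
      (b : BoundaryData (𝓡∂ 3) H (𝓡 2)) [ConnectedSpace b.carrier] (x : b.carrier)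
      (μ : SurfaceGroup g ≃* FundamentalGroup b.carrier x)
      (f f' : b.carrier ≃ₘ⟮𝓡 2, 𝓡 2⟯ b.carrier)
      (Y : Type) [TopologicalSpace Y] [ChartedSpace (EuclideanSpace ℝ (Fin 3)) Y]
      [IsManifold (𝓡 3) ∞ Y] (j j' : H → Y) (_ : IsBoundaryGluingWith b b f (𝓡 3) j j')
      (Y' : Type) [TopologicalSpace Y'] [ChartedSpace (EuclideanSpace ℝ (Fin 3)) Y']
      [IsManifold (𝓡 3) ∞ Y'] (J J' : H → Y') (_ : IsBoundaryGluingWith b b f' (𝓡 3) J J')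
      (Φ : Y ≃ₘ⟮𝓡 3, 𝓡 3⟯ Y') (ψ₁ ψ₂ : H ≃ₘ⟮𝓡∂ 3, 𝓡∂ 3⟯ H)
      (_ : Φ ∘ j = J ∘ ψ₁) (_ : Φ ∘ j' = J' ∘ ψ₂),
      ∃ σ : SurfaceGroup g ≃* SurfaceGroup g,
        (markedKernel μ ⟨b.incl, b.continuous_incl⟩).map σ.toMonoidHom =
          markedKernel μ ⟨b.incl, b.continuous_incl⟩ ∧
        (markedKernel μ ⟨b.incl ∘ f, b.continuous_incl.comp f.continuous⟩).map σ.toMonoidHom =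
          markedKernel μ ⟨b.incl ∘ f', b.continuous_incl.comp f'.continuous⟩ := by
  sorry

/-! ## 2. Sorry-free glue: subgroup transport -/

section algebra

variable {G : Type*} [Group G]

/-- `(α.trans β)` as a monoid hom is the composite. [folklore] -/
theorem toMonoidHom_trans {G' G'' : Type*} [Group G'] [Group G''] (α : G ≃* G') (β : G' ≃* G'') :
    (α.trans β).toMonoidHom = β.toMonoidHom.comp α.toMonoidHom :=
  MonoidHom.ext fun _ => rfl

/-- Mapping a subgroup along `α.trans β` is mapping along `α` then `β`. [folklore] -/
theorem map_trans (A : Subgroup G) (α β : G ≃* G) :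
    A.map (α.trans β).toMonoidHom = (A.map α.toMonoidHom).map β.toMonoidHom := by
  rw [toMonoidHom_trans, Subgroup.map_map]

/-- Mapping along `α` then `α⁻¹` is the identity. [folklore] -/
theorem map_map_symm (A : Subgroup G) (α : G ≃* G) :
    (A.map α.toMonoidHom).map α.symm.toMonoidHom = A := by
  rw [← map_trans, MulEquiv.self_trans_symm]
  have : (MulEquiv.refl G).toMonoidHom = MonoidHom.id G := MonoidHom.ext fun _ => rfl
  rw [this, Subgroup.map_id]

/-- If `α` carries `A` onto `B` then `B.comap α = A`. [folklore] -/
theorem comap_eq_of_map_eq {A B : Subgroup G} (α : G ≃* G) (h : A.map α.toMonoidHom = B) :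
    B.comap α.toMonoidHom = A := by
  rw [← h, Subgroup.comap_map_eq_self_of_injective (by exact α.injective)]

end algebra

/-- Re-marking: the marked kernel of `β ≫ μ` is the `β`-preimage of that of `μ`. [folklore] -/
theorem markedKernel_trans {g : ℕ} {F Z : Type*} [TopologicalSpace F] [TopologicalSpace Z] {x : F}
    (β : SurfaceGroup g ≃* SurfaceGroup g) (μ : SurfaceGroup g ≃* FundamentalGroup F x) (e : C(F, Z)) :
    markedKernel (β.trans μ) e = (markedKernel μ e).comap β.toMonoidHom := by
  unfold markedKernel
  rw [toMonoidHom_trans, Subgroup.comap_comap]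

/-- Marked kernels are normal (preimages of a kernel). [folklore] -/
instance markedKernel_normal {g : ℕ} {F Z : Type*} [TopologicalSpace F] [TopologicalSpace Z] {x : F}
    (μ : SurfaceGroup g ≃* FundamentalGroup F x) (e : C(F, Z)) : (markedKernel μ e).Normal := by
  unfold markedKernel
  infer_instance

/-! ### `π₁` bookkeeping: functoriality and change of base point (sorry-free) -/

section pi1

variable {F Z W : Type*} [TopologicalSpace F] [TopologicalSpace Z] [TopologicalSpace W]

/-- Functoriality of `π₁` on elements: `π₁(e' ∘ e) = π₁(e') ∘ π₁(e)`. [folklore] -/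
theorem map_comp_apply (e : C(F, Z)) (e' : C(Z, W)) (x : F) (c : FundamentalGroup F x) :
    FundamentalGroup.map (e'.comp e) x c =
      FundamentalGroup.map e' (e x) (FundamentalGroup.map e x c) := by
  induction c using Quotient.ind with
  | _ γ =>
    change (⟦(γ.map (e'.comp e).continuous)⟧ : Path.Homotopic.Quotient _ _) =
      ⟦(γ.map e.continuous).map e'.continuous⟧
    rw [Path.map_map]
    rfl

/-- Naturality of the change of base point: `π₁(e) ∘ T_ζ = T_{e ∘ ζ} ∘ π₁(e)`.
[cite: HatcherAT2002, Prop. 1.5] -/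
theorem map_conjPath_apply (e : C(F, Z)) {x y : F} (ζ : Path x y) (c : FundamentalGroup F x) :
    FundamentalGroup.map e y (FundamentalGroup.fundamentalGroupMulEquivOfPath ζ c) =
      FundamentalGroup.fundamentalGroupMulEquivOfPath (ζ.map e.continuous)
        (FundamentalGroup.map e x c) := by
  induction c using Quotient.ind with
  | _ γ =>
    change (⟦((ζ.symm.trans (γ.trans ζ)).map e.continuous)⟧ : Path.Homotopic.Quotient _ _) =
      ⟦(ζ.map e.continuous).symm.trans ((γ.map e.continuous).trans (ζ.map e.continuous))⟧
    rw [Path.map_trans, Path.map_trans, Path.map_symm]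

/-- **Reading the kernel of the reglued copy.** If `T_ζ ∘ π₁(f) ∘ μ = μ ∘ θ` (the realisation
datum supplied by Dehn–Nielsen–Baer), then the kernel of the copy of `H` glued on along `f`, read
through `μ`, is the `θ`-preimage of the handlebody kernel: `A_f = A.comap θ`. (Change of base point
along `ζ` commutes with `π₁(∂H ↪ H)`, and kernels are insensitive to the isomorphism `T_{ι ∘ ζ}`.)
[cite: Hempel1976, Lemma 14.4] -/
theorem markedKernel_comp_eq_comap {g : ℕ} {x : F} (μ : SurfaceGroup g ≃* FundamentalGroup F x)
    (ι : C(F, Z)) (f : C(F, F)) (ζ : Path (f x) x) (θ : SurfaceGroup g ≃* SurfaceGroup g)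
    (hf : ∀ s : SurfaceGroup g, FundamentalGroup.fundamentalGroupMulEquivOfPath ζ
      (FundamentalGroup.map f x (μ s)) = μ (θ s)) :
    markedKernel μ (ι.comp f) = (markedKernel μ ι).comap θ.toMonoidHom := by
  ext s
  simp only [markedKernel, Subgroup.mem_comap, MonoidHom.mem_ker, MulEquiv.coe_toMonoidHom]
  rw [← hf s, map_conjPath_apply, map_comp_apply, MulEquiv.map_eq_one_iff]
  exact Iff.rfl

end pi1

/-- The standard kernels are normal. [folklore] -/
instance stdKernel_normal (m : ℕ) (i : Fin 3) : (s4Kernels.stabilizeIter m i).Normal :=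
  (Summit.SmoothPoincare4.SmoothPoincare4.Theorems.WaldhausenPairs.Negative.stabilizeIter_isGroupTrisection m).normal i

/-! ## 3. Sorry-free glue: the marking with kernel literally `N i` (W1 + the model) -/

/-- **Re-marking by W1.** Given a marked model handlebody whose marking kernel is a handlebody
kernel, and any handlebody kernel `A` of `S_{3+3m}`, W1 re-marks the boundary so that the marking
kernel is LITERALLY `A`. (This is where the line replaces the printed realisation lemma
Leininger–Reid 2.2 / Jaco by algebra.) -/
theorem exists_marking_eq (m : ℕ) {F Z : Type*} [TopologicalSpace F] [TopologicalSpace Z] {x : F}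
    (μ₀ : SurfaceGroup (3 + 3 * m) ≃* FundamentalGroup F x) (e : C(F, Z))
    (h₀ : IsFreeOfRank (SurfaceGroup (3 + 3 * m) ⧸ normalClosure
      (markedKernel μ₀ e : Set (SurfaceGroup (3 + 3 * m)))) (3 + 3 * m))
    (A : Subgroup (SurfaceGroup (3 + 3 * m))) [A.Normal]
    (hA : IsFreeOfRank (SurfaceGroup (3 + 3 * m) ⧸ normalClosure (A : Set (SurfaceGroup (3 + 3 * m))))
      (3 + 3 * m)) :
    ∃ μ : SurfaceGroup (3 + 3 * m) ≃* FundamentalGroup F x, markedKernel μ e = A := by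
  obtain ⟨β, hβ⟩ := stub_handlebodyKernelsOneOrbit m A (markedKernel μ₀ e) inferInstance
    inferInstance hA h₀
  exact ⟨β.trans μ₀, by rw [markedKernel_trans, comap_eq_of_map_eq β hβ]⟩

/-! ## 4. Sorry-free glue: `PairRegluing` from stubs 1–7 -/

/-- Freeness of the single quotient of an automorphic image of a standard kernel. [folklore] -/
theorem isFreeOfRank_quot_map_std (m : ℕ) (j : Fin 3)
    (ρ : SurfaceGroup (3 + 3 * m) ≃* SurfaceGroup (3 + 3 * m)) :
    IsFreeOfRank (SurfaceGroup (3 + 3 * m) ⧸ normalClosure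
      (((s4Kernels.stabilizeIter m j).map ρ.toMonoidHom : Subgroup (SurfaceGroup (3 + 3 * m))) :
        Set (SurfaceGroup (3 + 3 * m)))) (3 + 3 * m) :=
  (Summit.SmoothPoincare4.SmoothPoincare4.Theorems.WaldhausenPairs.Negative.IsGroupTrisection.map_mulEquiv
    (Summit.SmoothPoincare4.SmoothPoincare4.Theorems.WaldhausenPairs.Negative.stabilizeIter_isGroupTrisection m)
    ρ).free_quotient j

/-- Automorphic images of standard kernels are normal. [folklore] -/
instance map_std_normal (m : ℕ) (j : Fin 3)
    (ρ : SurfaceGroup (3 + 3 * m) ≃* SurfaceGroup (3 + 3 * m)) :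
    ((s4Kernels.stabilizeIter m j).map ρ.toMonoidHom).Normal :=
  Subgroup.Normal.map inferInstance _ (by exact ρ.surjective)

/-- **The geometric half, assembled.** `PairRegluing` from the model (stub 2), W1 (stub 1, through
`exists_marking_eq` and the choice of `θ`), Dehn–Nielsen–Baer (stub 3), regluing (stub 4), the
KSP∘Waldhausen composite (stubs 5–6 through the tree's proved
`heegaardSplittings_diffeomorphic_of_isFreeOfRank` on the proved model `exists_oneHandlebody_four`)
and transport (stub 7). -/
theorem pairRegluing : PairRegluing := by
  intro m i j hij ρ hfree
  -- the marked model, re-marked so that its kernel is literally `N i`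
  obtain ⟨H, _, _, _, _, _, b, _, x, μ₀, hH, hker₀⟩ := stub_markedModelHandlebody m
  set ι : C(b.carrier, H) := ⟨b.incl, b.continuous_incl⟩ with hι
  obtain ⟨μ, hμ⟩ := exists_marking_eq m μ₀ ι hker₀ (s4Kernels.stabilizeIter m i)
    ((Summit.SmoothPoincare4.SmoothPoincare4.Theorems.WaldhausenPairs.Negative.stabilizeIter_isGroupTrisection
      m).free_quotient i)
  -- instances on the boundary surface `F = b.carrier`
  haveI : T2Space b.carrier := b.t2Space_carrier
  haveI : SecondCountableTopology b.carrier := b.secondCountableTopology_carrier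
  haveI : CompactSpace b.carrier := hH.compactSpace_carrier b
  -- W1 twice more: `θρ` with `(N i).comap θρ = ρ N j`, `θ₁` with `(N i).comap θ₁ = N j`
  obtain ⟨θρ, hθρ⟩ := stub_handlebodyKernelsOneOrbit m ((s4Kernels.stabilizeIter m j).map ρ.toMonoidHom)
    (s4Kernels.stabilizeIter m i) inferInstance inferInstance (isFreeOfRank_quot_map_std m j ρ)
    ((Summit.SmoothPoincare4.SmoothPoincare4.Theorems.WaldhausenPairs.Negative.stabilizeIter_isGroupTrisection
      m).free_quotient i)
  obtain ⟨θ₁, hθ₁⟩ := stub_handlebodyKernelsOneOrbit m (s4Kernels.stabilizeIter m j)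
    (s4Kernels.stabilizeIter m i) inferInstance inferInstance
    ((Summit.SmoothPoincare4.SmoothPoincare4.Theorems.WaldhausenPairs.Negative.stabilizeIter_isGroupTrisection
      m).free_quotient j)
    ((Summit.SmoothPoincare4.SmoothPoincare4.Theorems.WaldhausenPairs.Negative.stabilizeIter_isGroupTrisection
      m).free_quotient i)
  have hcomapρ : (s4Kernels.stabilizeIter m i).comap θρ.toMonoidHom =
      (s4Kernels.stabilizeIter m j).map ρ.toMonoidHom := comap_eq_of_map_eq θρ hθρ
  have hcomap₁ : (s4Kernels.stabilizeIter m i).comap θ₁.toMonoidHom = s4Kernels.stabilizeIter m j :=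
    comap_eq_of_map_eq θ₁ hθ₁
  -- Dehn–Nielsen–Baer: realise `θρ`, `θ₁` by diffeomorphisms of `F`, and read the reglued kernels
  obtain ⟨fρ, ζρ, hfρ⟩ := stub_dehnNielsenBaer b.carrier (3 + 3 * m) x μ θρ
  obtain ⟨f₁, ζ₁, hf₁⟩ := stub_dehnNielsenBaer b.carrier (3 + 3 * m) x μ θ₁
  have hkerρ : markedKernel μ ⟨b.incl ∘ fρ, b.continuous_incl.comp fρ.continuous⟩ =
      (markedKernel μ ι).comap θρ.toMonoidHom :=
    markedKernel_comp_eq_comap μ ι ⟨fρ, fρ.continuous⟩ ζρ θρ hfρ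
  have hker₁ : markedKernel μ ⟨b.incl ∘ f₁, b.continuous_incl.comp f₁.continuous⟩ =
      (markedKernel μ ι).comap θ₁.toMonoidHom :=
    markedKernel_comp_eq_comap μ ι ⟨f₁, f₁.continuous⟩ ζ₁ θ₁ hf₁
  -- reglue the model along them
  obtain ⟨Yρ, _, _, _, _, _, _, _, hYρo, jρ, jρ', hglueρ, ⟨eρ⟩⟩ :=
    stub_regluedDouble (3 + 3 * m) H hH b x μ fρ
  obtain ⟨Y₁, _, _, _, _, _, _, _, hY₁o, j₁, j₁', hglue₁, ⟨e₁⟩⟩ :=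
    stub_regluedDouble (3 + 3 * m) H hH b x μ f₁
  -- fundamental groups of the two reglued doubles are free of rank `m+1`
  rw [hkerρ] at eρ
  rw [hker₁] at e₁
  rw [hμ] at eρ e₁ hkerρ hker₁
  rw [hcomapρ] at eρ hkerρ
  rw [hcomap₁] at e₁ hker₁
  have hπρ : IsFreeOfRank (FundamentalGroup Yρ (jρ (b.incl x))) (m + 1) :=
    hfree.of_mulEquiv eρ
  have hπ₁ : IsFreeOfRank (FundamentalGroup Y₁ (j₁ (b.incl x))) (m + 1) :=
    ((Summit.SmoothPoincare4.SmoothPoincare4.Theorems.WaldhausenPairs.Negative.stabilizeIter_isGroupTrisection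
      m).free_pairQuotient i j hij).of_mulEquiv e₁
  -- the model 1-handlebody `V` with `m+1` one-handles (proved in the tree) and its boundary datum
  obtain ⟨V, _, _, _, _, _, _, _, hVo, hV, -⟩ := exists_oneHandlebody_four (m + 1)
  -- Kneser–Stallings–Perelman + Waldhausen: the two splittings are diffeomorphic as triples
  obtain ⟨Φ, ψ₁, ψ₂, hΦ₁, hΦ₂⟩ :=
    heegaardSplittings_diffeomorphic_of_isFreeOfRank stub_kneserStallingsPerelman stub_waldhausen
      (m + 1) V hV hVo (BoundaryManifold.boundaryData 3 V) Y₁ hY₁o _ hπ₁ Yρ hYρo _ hπρ (3 + 3 * m)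
      H H b b f₁ j₁ j₁' hH hH hglue₁ H H b b fρ jρ jρ' hH hH hglueρ
  -- transport the diffeomorphism of triples to an automorphism of `S`
  obtain ⟨σ, hσ₁, hσ₂⟩ := stub_triplesTransport (3 + 3 * m) H b x μ f₁ fρ Y₁ j₁ j₁' hglue₁
    Yρ jρ jρ' hglueρ Φ ψ₁ ψ₂ hΦ₁ hΦ₂
  refine ⟨σ, ?_, ?_⟩
  · rw [hμ] at hσ₁
    exact hσ₁
  · rw [hker₁, hkerρ] at hσ₂
    exact hσ₂

/-! ## 5. Sorry-free glue: transport of the pair quotient -/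

/-- Transport of the pair quotient along an automorphism: `S ⧸ ⟪αA ∪ αB⟫ ≅ S ⧸ ⟪A ∪ B⟫`. [folklore] -/
theorem isFreeOfRank_pairQuotient_map {g k : ℕ} (A B : Subgroup (SurfaceGroup g))
    (α : SurfaceGroup g ≃* SurfaceGroup g)
    (h : IsFreeOfRank (SurfaceGroup g ⧸ normalClosure ((A : Set (SurfaceGroup g)) ∪ B)) k) :
    IsFreeOfRank (SurfaceGroup g ⧸ normalClosure
      ((A.map α.toMonoidHom : Set (SurfaceGroup g)) ∪ B.map α.toMonoidHom)) k := by
  have hset : ((A.map α.toMonoidHom : Set (SurfaceGroup g)) ∪ B.map α.toMonoidHom) =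
      α.toMonoidHom '' ((A : Set (SurfaceGroup g)) ∪ B) := by
    rw [Set.image_union]; rfl
  have hnc : normalClosure ((A.map α.toMonoidHom : Set (SurfaceGroup g)) ∪ B.map α.toMonoidHom) =
      (normalClosure ((A : Set (SurfaceGroup g)) ∪ B)).map α.toMonoidHom := by
    rw [hset, Subgroup.map_normalClosure _ _ α.surjective]
  refine h.of_mulEquiv ((QuotientGroup.congr _ _ α ?_))
  rw [hnc]; rfl

/-! ## 6. Composition: the seven stubs prove the crux BY NAME -/

/-- **Composition — W1 + `PairRegluing` ⇒ the crux** (the card's kernel-checked reduction, inlined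
so that exactly ONE theorem of this file concludes the crux): standardise `K i`, `K j` separately by
W1 (`stub_handlebodyKernelsOneOrbit`, using the load-bearing `free_quotient`), transport the pair to
the reglued standard pair `(N i, ρ N j)`, `ρ = αⱼ ≫ αᵢ⁻¹` (its pair quotient is free of rank `m+1`
by the load-bearing `free_pairQuotient`, transported), apply `pairRegluing` (stubs 2–7), compose
`σ ≫ αᵢ`. `σ ≠ 1` in general — this is where `not_pairTransfer` bites and is honoured. No
hypotheses; `sorry` only inside `stub_*`. -/
theorem WaldhausenPairs_of :
    _root_.Summit.SmoothPoincare4.SmoothPoincare4.Theses.CongruenceShadows.WaldhausenPairs := by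
  intro m K hK i j hij
  have hN := Summit.SmoothPoincare4.SmoothPoincare4.Theorems.WaldhausenPairs.Negative.stabilizeIter_isGroupTrisection m
  obtain ⟨αi, hαi⟩ := stub_handlebodyKernelsOneOrbit m (s4Kernels.stabilizeIter m i) (K i) (hN.normal i)
    (hK.normal i) (hN.free_quotient i) (hK.free_quotient i)
  obtain ⟨αj, hαj⟩ := stub_handlebodyKernelsOneOrbit m (s4Kernels.stabilizeIter m j) (K j) (hN.normal j)
    (hK.normal j) (hN.free_quotient j) (hK.free_quotient j)
  have hKi : (K i).map αi.symm.toMonoidHom = s4Kernels.stabilizeIter m i := by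
    rw [← hαi, map_map_symm]
  have hKj : (K j).map αi.symm.toMonoidHom =
      (s4Kernels.stabilizeIter m j).map (αj.trans αi.symm).toMonoidHom := by
    rw [← hαj, map_trans]
  have hfree : IsFreeOfRank (SurfaceGroup (3 + 3 * m) ⧸ normalClosure
      ((s4Kernels.stabilizeIter m i : Set (SurfaceGroup (3 + 3 * m))) ∪
        (s4Kernels.stabilizeIter m j).map (αj.trans αi.symm).toMonoidHom)) (m + 1) := by
    have := isFreeOfRank_pairQuotient_map (K i) (K j) αi.symm (hK.free_pairQuotient i j hij)
    rwa [hKi, hKj] at this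
  obtain ⟨σ, hσi, hσj⟩ := pairRegluing m i j hij (αj.trans αi.symm) hfree
  refine ⟨σ.trans αi, ?_, ?_⟩
  · rw [map_trans, hσi, hαi]
  · rw [map_trans, hσj, ← map_trans]
    have : ((αj.trans αi.symm).trans αi).toMonoidHom = αj.toMonoidHom :=
      MonoidHom.ext fun x => by simp
    rw [this, hαj]

end Summit.SmoothPoincare4.SmoothPoincare4.Cruxes.WaldhausenPairs.ZieschangOrbitDnbRegluing

end
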